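import Literature.NumberTheory.Automorphic.LanglandsTetrahedralLeaves
import Literature.NumberTheory.Automorphic.PairLFunctionPolesRepDataRealisation
import Literature.NumberTheory.Automorphic.GLnCentralCharacter
import Literature.NumberTheory.Automorphic.IdeleClassGroupProofs
import Literature.NumberTheory.GaloisRepresentations.HeckeCharacterWeakApproximation
import Literature.NumberTheory.GaloisRepresentations.HeckeCharacterNormTwistProofs
import Literature.NumberTheory.GaloisRepresentations.HeckeCharacterNormOneProofs
import HarnessLib

/-!
# `JacquetShalika_eq_of_rsData_eq` (Gelbart 1997, Thm. 5.3.3 as used on p. 257): the unitary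
# shift vanishes by central characters, and the fact from five named-fact leaves

Topic `NumberTheory/Automorphic`; namespace `Literature.NumberTheory.Automorphic`. Proof file
(theorems only: no definition, no named fact, no instance), third sibling of `LanglandsTetrahedral`
under the named fact `JacquetShalika_eq_of_rsData_eq` (two cuspidal automorphic representations
`Π, Π'` of `GL_n(𝔸_F)` — Borel–Jacquet data, arbitrary central characters — whose local
Rankin–Selberg data `{α'_i / α_j} = {α_i / α_j}` agree at almost every place have the same Satake
parameters at almost every place; Gelbart, *Three lectures …*, in Cornell–Silverman–Stevens (1997),
Thm. 5.3.3 (Jacquet–Shalika 1981) in the form used in §7.1, p. 257), after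
`LanglandsTetrahedralProofs` (`JacquetShalika_eq_of_rsData_eq_of_L2`) and
`LanglandsTetrahedralLeaves` (`JacquetShalika_eq_of_rsData_eq_of_leaves'`, seven leaves).

This file removes two of the seven leaves.

1. **The unitary shift vanishes for free** (`CuspidalAutomorphicRepGL.shift_eq_zero_of_satakeTensor_conj`).
   In the `L²` core of the printed argument one meets cuspidal `π, π' ⊂ L²_cusp(GL_n(K) A_G \ GL_n(𝔸_K))`
   with Satake families `α, α'` off a finite `S` and a real `τ` with
   `q_w^{iτ} (t_{π',w} ⊗ \bar t_{π,w}) = t_{π,w} ⊗ \bar t_{π,w}` for `w ∉ S` (the imaginary part of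
   the difference of the two `|det|^s`-normalisations). `LanglandsTetrahedralProofs` killed `τ` with
   the boundary fact `JacquetShalika1981_partialPairL_boundary_of_ne_one` (holomorphy *and
   non-vanishing* of `L^S(s, π' × π̃)` on `re s = 1`, `s ≠ 1` — Shahidi). It is not needed: taking
   determinants, `q_w^{i n² τ} ω_{π'}(ϖ_w)^n = ω_π(ϖ_w)^n` for the **central characters**
   `ω_π, ω_{π'}` (`CuspidalAutomorphicRepGL.exists_centralCharacter` of `GLnCentralCharacter`:
   `ω_π(ϖ_w) = e_n(t_{π,w})`, `|e_n(t_{π,w})| = 1`), so the Hecke characters `(ω_{π'} ω_π⁻¹)^n` and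
   `‖·‖^{i n² τ}` agree at almost all uniformizers, hence are equal (rigidity of Hecke characters,
   `HeckeCharacter.ext_of_eventually_valueAtUniformizer_eq`, Cassels–Fröhlich Ch. VII §4 Prop. 4.1);
   but `ω_π, ω_{π'}` are trivial on `A_G = ℝ_{>0}` while `‖ρ(r)‖^{i n² τ} = r^{[K:ℚ] i n² τ}`
   (`ideleNorm_posRealIdele_holds`), so `τ = 0` (`eq_of_forall_ofReal_cpow_eq`). This is the
   remark "comparing central characters, the twists agree" implicit in "we may assume `π`, `π'`
   unitary" (Arthur–Clozel, proof of Thm. 3.1; Gelbart §7.1 (a), p. 254: "the central character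
   … base change lifts to the central character").
2. **The `L²` rigidity from the minimal analytic input**
   (`CuspidalAutomorphicRepGL.eq_of_satakeTensor_conj_of_continuity_of_divergence`,
   `…_shift_of_continuity_of_divergence`, `…_shift'`): equal pair families
   `t_{π',w} ⊗ \bar t_{π,w} = t_{π,w} ⊗ \bar t_{π,w}` off `S` give `L^S(s, π' × π̄) = L^S(s, π × π̄)`
   identically; the right side diverges at `s = 1` (divergence half of Arthur–Clozel (2.3)) and the
   left side has a finite limit there if `π' ≠ π` (continuity half of (2.2), Jacquet–Shalika II
   Prop. 3.6, under multiplicity one) — Gelbart's "by the same Theorem 5.3.3, `Π₁* ≅ Π₁`" (p. 257).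
3. **The glue over an abstract unitary normalisation**
   (`JacquetShalika_eq_of_rsData_eq_of_normalisation`): the Borel–Jacquet ↔ `L²` dictionary enters
   the printed proof only through "`t_{π,w} = q_w^{s} t_{P,w}` off a finite set for some cuspidal
   `P ⊂ L²_cusp`" (Borel–Jacquet 1979, 5.7), which the tree now derives from three alternative
   bases: the dictionary `exists_isAssociatedL2` + `hasSatakeParamAt_iff_L2`
   (`CuspidalAutomorphicRepData.exists_satake_eq_cpow_mul_L2_of_clean`, `LanglandsTetrahedralProofs`),
   the realisation fact `AutomorphicRepsGL.exists_le_formsOfL2_of_W'_eq_bot`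
   (`…_of_realisation`, `PairLFunctionPolesRepDataRealisation`), or Harish-Chandra's density half
   `AutomorphicRepsGL.cuspidal_closure_exists_mem_l2OfForms` (`…_of_closure_exists_mem`), each with
   the semisimplicity fact `AutomorphicRepsGL.stable_cuspidal_eq_sSup_irreducible` for clean models.

Resulting reductions of the named fact (all proved here):

* `JacquetShalika_eq_of_rsData_eq_of_leaves''` ⟸ `JacquetShalika1981_partialPairL_at_one_of_ne_conj`,
  `…_pole_of_eq_conj`, `multiplicity_one_gl`, `AutomorphicRepsGL.exists_isAssociatedL2`,
  `hasSatakeParamAt_iff_L2`, `AutomorphicRepsGL.stable_cuspidal_eq_sSup_irreducible`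
  (`_of_leaves'` without the boundary fact);
* `JacquetShalika_eq_of_rsData_eq_of_realisation_leaves` ⟸ (2.2) at `1`, (2.3), multiplicity one,
  `AutomorphicRepsGL.exists_le_formsOfL2_of_W'_eq_bot`, `stable_cuspidal_eq_sSup_irreducible`
  (**five leaves**);
* `JacquetShalika_eq_of_rsData_eq_of_closure_leaves` ⟸ (2.2) at `1`, (2.3), multiplicity one,
  `AutomorphicRepsGL.cuspidal_closure_exists_mem_l2OfForms`, `stable_cuspidal_eq_sSup_irreducible`
  (five leaves);
* `JacquetShalika_eq_of_rsData_eq_of_normalisation_of_continuity_of_divergence` — the minimal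
  analytic input (continuity half of (2.2), divergence half of (2.3), multiplicity one) over any
  unitary normalisation.

No statement of the tree is modified; nothing here restates or weakens a vendored fact.

## References

* S. Gelbart, *Three lectures on the modularity of `ρ̄_{E,3}` and the Langlands reciprocity
  conjecture*, in *Modular forms and Fermat's last theorem* (1997), Thm. 5.3.3, §7.1 pp. 254–257
  [Gelbart1997].
* H. Jacquet, J. A. Shalika, *On Euler products and the classification of automorphic forms II*,
  Amer. J. Math. 103 (1981), 777–815, Prop. 3.6 [JacquetShalikaAJM1981II].
* J. Arthur, L. Clozel, *Simple algebras, base change, and the advanced theory of the trace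
  formula*, Ann. of Math. Stud. 120 (1989), Ch. 3 §2 (2.2)–(2.3) and proof of Thm. 3.1
  [ArthurClozelAMS120].
* A. Borel, H. Jacquet, *Automorphic forms and automorphic representations*, Proc. Sympos. Pure
  Math. 33 (1979), part 1, §4.6 and 5.7 [BorelJacquetCorvallis1979].
* J. W. S. Cassels, A. Fröhlich (eds.), *Algebraic Number Theory* (1967), Ch. VII §4 Prop. 4.1;
  J. Tate, *Fourier analysis in number fields …*, ibid., §4.3 [CasselsFrohlichANT1967]
  [TateThesis1967].
-/

noncomputable section

open scoped MatrixGroups NNReal Classical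
open NumberField IsDedekindDomain MeasureTheory Filter Topology

namespace Literature.NumberTheory.Automorphic

open AdelicGroupData
open Literature.NumberTheory.GaloisRepresentations (HeckeCharacter ideleGroup localUnits ideleNorm
  eq_of_forall_ofReal_cpow_eq)

/-! ### Multiset and Hecke-character bookkeeping -/

section Bookkeeping

/-- `∏ (c · M) = c^{#M} ∏ M`. [folklore] -/
private theorem prod_map_const_mul' (c : ℂ) (M : Multiset ℂ) :
    (M.map (c * ·)).prod = c ^ Multiset.card M * M.prod := by
  rw [Multiset.prod_map_mul, Multiset.map_const', Multiset.prod_replicate, Multiset.map_id']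

/-- **Determinant of a tensor product** on eigenvalue multisets:
`∏ (α ⊗ β) = (∏ α)^{#β} (∏ β)^{#α}` (local copy of `prod_satakeTensor` of
`RamakrishnanBoxTimesProofs`, not imported here). [folklore] -/
private theorem prod_satakeTensor' (α β : Multiset ℂ) :
    (satakeTensor α β).prod = α.prod ^ Multiset.card β * β.prod ^ Multiset.card α := by
  induction α using Multiset.induction_on with
  | empty => simp [satakeTensor_zero_left]
  | cons a α ih =>
    rw [satakeTensor_cons_left, Multiset.prod_add, ih, Multiset.prod_map_mul, Multiset.map_const',
      Multiset.prod_replicate, Multiset.map_id', Multiset.prod_cons, Multiset.card_cons]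
    ring

variable {K : Type} [Field K] [NumberField K]

/-- `‖ϖ_v‖_v = q_v⁻¹` for the tree's uniformizer (local copy of `HeckeCharacter.norm_uniformizer`
of `GaloisRepresentations/HeckeLFunctionNonvanishingLineProofs`, stated with `residueCard` and not
imported, to keep this file off the Hecke `L`-function cone). [folklore] -/
private theorem norm_uniformizer' (v : HeightOneSpectrum (𝓞 K)) :
    ‖(HeckeCharacter.uniformizer K v : v.adicCompletion K)‖ = (v.residueCard : ℝ)⁻¹ := by
  rw [FinitePlace.norm_def, HeckeCharacter.valued_uniformizer, WithZero.exp,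
    WithZeroMulInt.toNNReal_neg_apply _ WithZero.coe_ne_zero, WithZero.unzero_coe, toAdd_ofAdd,
    zpow_neg, zpow_one, NNReal.coe_inv, NNReal.coe_natCast]
  rfl

/-- **A norm twist `‖·‖^z` takes the value `q_v^{-z}` at (a uniformizer of) `v`**
(`‖ϖ_v‖_𝔸 = q_v⁻¹`, `ideleNorm_localUnits`); Tate's thesis §4.3 (`|π|^s = Np^{-s}`).
[cite: TateThesis1967, §4.3] -/
private theorem valueAtUniformizer_of_eq_cpow_ideleNorm' {ν : HeckeCharacter K} {z : ℂ}
    (hz : ∀ x : ideleGroup K, ((ν x : ℂˣ) : ℂ) = (ideleNorm x : ℂ) ^ z)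
    (v : HeightOneSpectrum (𝓞 K)) :
    ν.valueAtUniformizer v = ((v.residueCard : ℂ) ^ z)⁻¹ := by
  rw [HeckeCharacter.valueAtUniformizer, HeckeCharacter.localComponent_apply, hz,
    Literature.NumberTheory.GaloisRepresentations.ideleNorm_localUnits, norm_uniformizer',
    Complex.ofReal_inv, Complex.ofReal_natCast,
    Complex.inv_cpow _ _ (by rw [Complex.natCast_arg]; exact Real.pi_ne_zero.symm)]

/-- **A norm twist trivial on `A_G = ℝ_{>0}` is trivial**: if `‖ρ(r)‖^z = 1` for all `r > 0`
(`ρ = posRealIdele`, `‖ρ(r)‖ = r^{[K:ℚ]}`, `ideleNorm_posRealIdele_holds`) then `z = 0`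
(`R^{[K:ℚ] z} = R^0` for all `R > 0` determines the exponent, `eq_of_forall_ofReal_cpow_eq`).
[cite: TateThesis1967, §4.3 (remark before §4.4)] -/
theorem eq_zero_of_forall_cpow_ideleNorm_posRealIdele_eq_one {z : ℂ}
    (h : ∀ r : ℝ≥0ˣ, ((ideleNorm (posRealIdele K r) : ℝ) : ℂ) ^ z = 1) : z = 0 := by
  have hd : ((Module.finrank ℚ K : ℕ) : ℂ) ≠ 0 := Nat.cast_ne_zero.2 Module.finrank_pos.ne'
  suffices hdz : ((Module.finrank ℚ K : ℕ) : ℂ) * z = 0 from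
    (mul_eq_zero.1 hdz).resolve_left hd
  refine eq_of_forall_ofReal_cpow_eq fun R hR => ?_
  have hR0 : (⟨R, hR.le⟩ : ℝ≥0) ≠ 0 := fun h0 => hR.ne' (congrArg NNReal.toReal h0)
  set r : ℝ≥0ˣ := Units.mk0 ⟨R, hR.le⟩ hR0 with hrdef
  have hr : ((r : ℝ≥0) : ℝ) = R := rfl
  have h1 := h r
  rw [← coe_ideleNorm, ideleNorm_posRealIdele_holds K r, NNReal.coe_pow, hr,
    Complex.ofReal_pow] at h1
  have him : (Complex.log R * ((Module.finrank ℚ K : ℕ) : ℂ)).im = 0 := by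
    rw [← Complex.ofReal_log hR.le, ← Complex.ofReal_natCast, ← Complex.ofReal_mul,
      Complex.ofReal_im]
  rw [Complex.cpow_zero, Complex.cpow_mul _ (by rw [him]; exact neg_lt_zero.2 Real.pi_pos)
    (by rw [him]; exact Real.pi_pos.le), Complex.cpow_natCast, h1]

end Bookkeeping

/-! ### The unitary shift vanishes: central characters -/

section Shift

variable {n : ℕ} {K : Type} [Field K] [NumberField K]
  {μ : Measure (gl n K).automorphicQuotient} [(gl n K).IsAutomorphicMeasure μ]

/-- **The unitary shift in the Rankin–Selberg comparison vanishes, by central characters.** Let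
`π, π' ⊂ L²_cusp(GL_n(K) A_G \ GL_n(𝔸_K))` be cuspidal (`n ≥ 1`) with Satake families `α, α'` off a
finite `S`, and `τ ∈ ℝ` with `q_w^{iτ} (t_{π',w} ⊗ \bar t_{π,w}) = t_{π,w} ⊗ \bar t_{π,w}` (eigenvalue
multisets) for `w ∉ S`. Then **`τ = 0`**. Proof: determinants give
`q_w^{i n² τ} e_n(t_{π',w})^n \bar{e_n(t_{π,w})}^n = e_n(t_{π,w})^n \bar{e_n(t_{π,w})}^n` with
`|e_n(t_{π,w})| = 1` (`HasSatakeParameterAt.norm_prod_eq_one`); the central characters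
`ω = ω_π`, `ω' = ω_{π'}` (`CuspidalAutomorphicRepGL.exists_centralCharacter`: unitary Hecke
characters trivial on `A_G`, `ω(ϖ_w) = e_n(t_{π,w})` off `S`) therefore satisfy
`((ω' ω⁻¹)^n)(ϖ_w) = q_w^{-i n² τ} = ‖·‖^{i n² τ}(ϖ_w)` for all `w ∉ S`, so
`(ω' ω⁻¹)^n = ‖·‖^{i n² τ}` (`HeckeCharacter.ext_of_eventually_valueAtUniformizer_eq`,
Cassels–Fröhlich VII §4 Prop. 4.1); evaluating on `A_G`, where `ω, ω'` are trivial and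
`‖ρ(r)‖ = r^{[K:ℚ]}`, gives `r^{[K:ℚ] i n² τ} = 1` for all `r > 0`, i.e. `τ = 0`. This replaces
the appeal to the boundary fact (2.2) on `re s = 1`, `s ≠ 1` in
`CuspidalAutomorphicRepGL.eq_of_satakeTensor_conj_shift`. [cite: ArthurClozelAMS120, Ch. 3, proof
of Thm. 3.1 ("we may assume `π`, `π'` unitary")] [cite: Gelbart1997, §7.1 (a), p. 254] -/
theorem CuspidalAutomorphicRepGL.shift_eq_zero_of_satakeTensor_conj (hn : 0 < n)
    (P P' : CuspidalAutomorphicRepGL n K μ) {S : Set (HeightOneSpectrum (𝓞 K))} (hS : S.Finite)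
    {α α' : SatakeFamily K} (hα : IsSatakeFamilyOf P S α) (hα' : IsSatakeFamilyOf P' S α')
    (τ : ℝ)
    (h : ∀ w ∉ S, (satakeTensor (α' w) ((α w).map (starRingEnd ℂ))).map
        (((w.residueCard : ℂ) ^ ((τ : ℂ) * Complex.I)) * ·) =
      satakeTensor (α w) ((α w).map (starRingEnd ℂ))) :
    τ = 0 := by
  classical
  -- the central characters of `π`, `π'` and the norm character `ν = ‖·‖^{n² iτ}`
  obtain ⟨ω, -, hωA, -, -, hωS⟩ := P.exists_centralCharacter
  obtain ⟨ω', -, hω'A, -, -, hω'S⟩ := P'.exists_centralCharacter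
  set z : ℂ := ((n * n : ℕ) : ℂ) * ((τ : ℂ) * Complex.I) with hz
  obtain ⟨ν, hν⟩ := exists_heckeCharacter_ideleNorm_cpow K z
  have hq : ∀ w : HeightOneSpectrum (𝓞 K), (w.residueCard : ℂ) ≠ 0 := fun w => by
    have := w.one_lt_residueCard
    exact_mod_cast (by omega : w.residueCard ≠ 0)
  have hqs : ∀ (w : HeightOneSpectrum (𝓞 K)) (t : ℂ), (w.residueCard : ℂ) ^ t ≠ 0 := fun w t h0 =>
    hq w ((Complex.cpow_eq_zero_iff _ _).1 h0).1
  -- `(ω' ω⁻¹)^n` and `ν` agree at the uniformizers off `S`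
  have key : ∀ w ∉ S, ((ω' * ω⁻¹) ^ n).valueAtUniformizer w = ν.valueAtUniformizer w := by
    intro w hw
    obtain ⟨𝔫, -, -, ϖ, hSat⟩ := hα w hw
    obtain ⟨𝔫', -, -, ϖ', hSat'⟩ := hα' w hw
    have hcard : Multiset.card (α w) = n := hSat.card_eq
    have hcard' : Multiset.card (α' w) = n := hSat'.card_eq
    have he0 : (α w).prod ≠ 0 := fun h0 => by
      have := hSat.norm_prod_eq_one; rw [h0, norm_zero] at this; exact zero_ne_one this
    have he0' : (α' w).prod ≠ 0 := fun h0 => by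
      have := hSat'.norm_prod_eq_one; rw [h0, norm_zero] at this; exact zero_ne_one this
    have hce0 : ((α w).map (starRingEnd ℂ)).prod ≠ 0 := by
      rw [← map_multiset_prod]
      exact (map_ne_zero (starRingEnd ℂ)).2 he0
    -- determinants of the tensor relation
    have hprod := congrArg Multiset.prod (h w hw)
    rw [prod_map_const_mul', card_satakeTensor, prod_satakeTensor', prod_satakeTensor',
      Multiset.card_map, hcard, hcard', ← mul_assoc] at hprod
    have hprod' : ((w.residueCard : ℂ) ^ ((τ : ℂ) * Complex.I)) ^ (n * n) * (α' w).prod ^ n =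
        (α w).prod ^ n :=
      mul_right_cancel₀ (pow_ne_zero n hce0) hprod
    -- the values at `ϖ_w`
    have hvω : ((ω (localUnits w (HeckeCharacter.uniformizer K w)) : ℂˣ) : ℂ) = (α w).prod :=
      (hωS hα w hw).2
    have hvω' : ((ω' (localUnits w (HeckeCharacter.uniformizer K w)) : ℂˣ) : ℂ) = (α' w).prod :=
      (hω'S hα' w hw).2
    rw [valueAtUniformizer_of_eq_cpow_ideleNorm' hν, hz, Complex.cpow_nat_mul,
      HeckeCharacter.valueAtUniformizer, HeckeCharacter.localComponent_apply,
      HeckeCharacter.pow_apply, HeckeCharacter.mul_apply, HeckeCharacter.inv_apply,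
      Units.val_pow_eq_pow_val, Units.val_mul, Units.val_inv_eq_inv_val, hvω, hvω', mul_pow,
      inv_pow, ← hprod', mul_inv, mul_left_comm, mul_inv_cancel₀ (pow_ne_zero n he0'), mul_one]
  -- hence they are equal (rigidity of Hecke characters)
  have hext : (ω' * ω⁻¹) ^ n = ν :=
    HeckeCharacter.ext_of_eventually_valueAtUniformizer_eq
      (Filter.eventually_cofinite.2 (hS.subset fun w hw => by
        by_contra hwS
        exact hw (key w hwS)))
  -- on `A_G` the left side is trivial, so `‖ρ(r)‖^z = 1` for all `r > 0`, and `z = 0`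
  have hAν : ∀ r : ℝ≥0ˣ, ((ideleNorm (posRealIdele K r) : ℝ) : ℂ) ^ z = 1 := fun r => by
    rw [← hν, ← hext, HeckeCharacter.pow_apply, HeckeCharacter.mul_apply,
      HeckeCharacter.inv_apply, hωA r, hω'A r, inv_one, mul_one, one_pow, Units.val_one]
  have hz0 : z = 0 := eq_zero_of_forall_cpow_ideleNorm_posRealIdele_eq_one hAν
  rw [hz] at hz0
  have hnn : ((n * n : ℕ) : ℂ) ≠ 0 := Nat.cast_ne_zero.2 (Nat.mul_ne_zero hn.ne' hn.ne')
  have hτI := (mul_eq_zero.1 hz0).resolve_left hnn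
  exact Complex.ofReal_eq_zero.1 ((mul_eq_zero.1 hτI).resolve_right Complex.I_ne_zero)

/-- **`L²` Rankin–Selberg rigidity from the minimal analytic input.** For one automorphic measure
and `n ≥ 1`, assume multiplicity one on `L²_cusp(GL_n)` (`hm1`), the *continuity half* of
Arthur–Clozel (2.2) at `s = 1` (`hcont`: for `π ≠ σ̄`, `L^S(s, π ⊗ σ)` has some finite limit as
`s → 1`, `re s > 1`; Jacquet–Shalika II, Prop. 3.6) and the *divergence half* of (2.3) (`hdiv`: for
`π = σ̄`, no finite limit there). If cuspidal `π, π'` with Satake families `α, α'` off a finite `S`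
satisfy `t_{π',w} ⊗ \bar t_{π,w} = t_{π,w} ⊗ \bar t_{π,w}` (eigenvalue multisets) for `w ∉ S` —
equality of the unramified local factors `L(s, π'_w × π̃_w) = L(s, π_w × π̃_w)` — then **`π' = π`**:
`L^S(s, π' × π̄) = L^S(s, π × π̄)` identically, the right side diverges at `1` (`π = (π̄)̄`) and the
left side has a finite limit there unless `π' = π`. Gelbart, p. 257: "`L(s, Π₁ × Π̃₁)` has a pole at
`s = 1` … therefore `L(s, Π₁* × Π̃₁)` also has a pole at `s = 1` … (by the same Theorem 5.3.3)
`Π₁* ≅ Π₁`". [cite: Gelbart1997, Thm. 5.3.3 and §7.1 p. 257]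
[cite: ArthurClozelAMS120, Ch. 3 §2 (2.2)–(2.3)] -/
theorem CuspidalAutomorphicRepGL.eq_of_satakeTensor_conj_of_continuity_of_divergence (hn : 0 < n)
    (hm1 : multiplicity_one_gl n K μ)
    (hcont : ∀ (_hn : 0 < n) (_h₁ : multiplicity_one_gl n K μ)
      (P P' : CuspidalAutomorphicRepGL n K μ) (_hne : P ≠ P'.conj)
      {S : Set (HeightOneSpectrum (𝓞 K))} (_hS : S.Finite)
      {α β : SatakeFamily K} (_hα : IsSatakeFamilyOf P S α) (_hβ : IsSatakeFamilyOf P' S β),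
      ∃ c : ℂ, Tendsto (partialPairL S α β) (𝓝[{s : ℂ | 1 < s.re}] 1) (𝓝 c))
    (hdiv : ∀ (_hn : 0 < n) (P P' : CuspidalAutomorphicRepGL n K μ) (_he : P = P'.conj)
      {S : Set (HeightOneSpectrum (𝓞 K))} (_hS : S.Finite)
      {α β : SatakeFamily K} (_hα : IsSatakeFamilyOf P S α) (_hβ : IsSatakeFamilyOf P' S β)
      (d : ℂ), ¬ Tendsto (partialPairL S α β) (𝓝[{s : ℂ | 1 < s.re}] 1) (𝓝 d))
    (P P' : CuspidalAutomorphicRepGL n K μ) {S : Set (HeightOneSpectrum (𝓞 K))} (hS : S.Finite)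
    {α α' : SatakeFamily K} (hα : IsSatakeFamilyOf P S α) (hα' : IsSatakeFamilyOf P' S α')
    (h : ∀ w ∉ S, satakeTensor (α' w) ((α w).map (starRingEnd ℂ)) =
      satakeTensor (α w) ((α w).map (starRingEnd ℂ))) :
    P' = P := by
  classical
  set β : SatakeFamily K := fun w => (α w).map (starRingEnd ℂ) with hβ
  have hβP : IsSatakeFamilyOf P.conj S β := hα.conj
  -- `L^S(s, π' × π̄) = L^S(s, π × π̄)` identically
  have hLL : partialPairL S α' β = partialPairL S α β := by
    funext s
    simp only [partialPairL]
    refine tprod_congr fun w => ?_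
    rw [satakePairPolynomial_eq_eulerPolynomial, satakePairPolynomial_eq_eulerPolynomial, hβ,
      h w.1 w.2]
  by_contra hne
  have hne' : P' ≠ P.conj.conj := by rwa [CuspidalAutomorphicRepGL.conj_conj]
  obtain ⟨d, hd⟩ := hcont hn hm1 P' P.conj hne' hS hα' hβP
  rw [hLL] at hd
  exact hdiv hn P P.conj (by rw [CuspidalAutomorphicRepGL.conj_conj]) hS hα hβP d hd

/-- **Jacquet–Shalika rigidity up to a unitary shift, `L²` model, from the minimal analytic input**
(as `CuspidalAutomorphicRepGL.eq_of_satakeTensor_conj_shift` of `LanglandsTetrahedralProofs`, with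
the boundary fact on `re s = 1` removed and (2.2)/(2.3) weakened to their continuity/divergence
halves): `q_w^{iτ} (t_{π',w} ⊗ \bar t_{π,w}) = t_{π,w} ⊗ \bar t_{π,w}` off a finite `S` forces
`τ = 0` (`shift_eq_zero_of_satakeTensor_conj`, central characters) and then `π' = π`
(`eq_of_satakeTensor_conj_of_continuity_of_divergence`). [cite: Gelbart1997, Thm. 5.3.3 and §7.1
p. 257] [cite: ArthurClozelAMS120, Ch. 3 §2 (2.2)–(2.3)] -/
theorem CuspidalAutomorphicRepGL.eq_of_satakeTensor_conj_shift_of_continuity_of_divergence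
    (hn : 0 < n) (hm1 : multiplicity_one_gl n K μ)
    (hcont : ∀ (_hn : 0 < n) (_h₁ : multiplicity_one_gl n K μ)
      (P P' : CuspidalAutomorphicRepGL n K μ) (_hne : P ≠ P'.conj)
      {S : Set (HeightOneSpectrum (𝓞 K))} (_hS : S.Finite)
      {α β : SatakeFamily K} (_hα : IsSatakeFamilyOf P S α) (_hβ : IsSatakeFamilyOf P' S β),
      ∃ c : ℂ, Tendsto (partialPairL S α β) (𝓝[{s : ℂ | 1 < s.re}] 1) (𝓝 c))
    (hdiv : ∀ (_hn : 0 < n) (P P' : CuspidalAutomorphicRepGL n K μ) (_he : P = P'.conj)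
      {S : Set (HeightOneSpectrum (𝓞 K))} (_hS : S.Finite)
      {α β : SatakeFamily K} (_hα : IsSatakeFamilyOf P S α) (_hβ : IsSatakeFamilyOf P' S β)
      (d : ℂ), ¬ Tendsto (partialPairL S α β) (𝓝[{s : ℂ | 1 < s.re}] 1) (𝓝 d))
    (P P' : CuspidalAutomorphicRepGL n K μ) {S : Set (HeightOneSpectrum (𝓞 K))} (hS : S.Finite)
    {α α' : SatakeFamily K} (hα : IsSatakeFamilyOf P S α) (hα' : IsSatakeFamilyOf P' S α')
    (τ : ℝ)
    (h : ∀ w ∉ S, (satakeTensor (α' w) ((α w).map (starRingEnd ℂ))).map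
        (((w.residueCard : ℂ) ^ ((τ : ℂ) * Complex.I)) * ·) =
      satakeTensor (α w) ((α w).map (starRingEnd ℂ))) :
    τ = 0 ∧ P' = P := by
  have hτ : τ = 0 := P.shift_eq_zero_of_satakeTensor_conj hn P' hS hα hα' τ h
  refine ⟨hτ, CuspidalAutomorphicRepGL.eq_of_satakeTensor_conj_of_continuity_of_divergence hn hm1
    hcont hdiv P P' hS hα hα' fun w hw => ?_⟩
  have := h w hw
  rwa [hτ, Complex.ofReal_zero, zero_mul, Complex.cpow_zero, map_one_mul] at this

/-- **Jacquet–Shalika rigidity up to a unitary shift, `L²` model, from the named facts (2.2) at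
`s = 1`, (2.3) and multiplicity one** — `CuspidalAutomorphicRepGL.eq_of_satakeTensor_conj_shift`
without its hypothesis `h22'` (`JacquetShalika1981_partialPairL_boundary_of_ne_one`).
[cite: Gelbart1997, Thm. 5.3.3 and §7.1 p. 257] [cite: ArthurClozelAMS120, Ch. 3 §2 (2.2)–(2.3)] -/
theorem CuspidalAutomorphicRepGL.eq_of_satakeTensor_conj_shift' (hn : 0 < n)
    (h22 : JacquetShalika1981_partialPairL_at_one_of_ne_conj (n := n) (K := K) (μ := μ))
    (h23 : JacquetShalika1981_partialPairL_pole_of_eq_conj (n := n) (K := K) (μ := μ))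
    (hm1 : multiplicity_one_gl n K μ)
    (P P' : CuspidalAutomorphicRepGL n K μ) {S : Set (HeightOneSpectrum (𝓞 K))} (hS : S.Finite)
    {α α' : SatakeFamily K} (hα : IsSatakeFamilyOf P S α) (hα' : IsSatakeFamilyOf P' S α')
    (τ : ℝ)
    (h : ∀ w ∉ S, (satakeTensor (α' w) ((α w).map (starRingEnd ℂ))).map
        (((w.residueCard : ℂ) ^ ((τ : ℂ) * Complex.I)) * ·) =
      satakeTensor (α w) ((α w).map (starRingEnd ℂ))) :
    τ = 0 ∧ P' = P :=
  CuspidalAutomorphicRepGL.eq_of_satakeTensor_conj_shift_of_continuity_of_divergence hn hm1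
    (continuity_of_JacquetShalika1981_partialPairL_at_one_of_ne_conj h22)
    (divergence_of_JacquetShalika1981_partialPairL_pole_of_eq_conj h23) P P' hS hα hα' τ h

end Shift

/-! ### `JacquetShalika_eq_of_rsData_eq` over an abstract unitary normalisation -/

section Glue

/-- `#(rsData β' β) = #β' · #β`. [folklore] -/
private theorem card_rsData' (β' β : Multiset ℂ) :
    Multiset.card (rsData β' β) = Multiset.card β' * Multiset.card β := by
  rw [rsData, Multiset.card_map, Multiset.card_product]

/-- **`JacquetShalika_eq_of_rsData_eq` from the minimal analytic input over any unitary
normalisation.** Granting, for all `GL_n` (`n ≥ 1`) over all number fields and all automorphic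
measures: multiplicity one on `L²_cusp(GL_n)` (`hm1`), the continuity half of Arthur–Clozel (2.2) at
`s = 1` (`hcont`) and the divergence half of (2.3) (`hdiv`), and the **unitary normalisation** of
cuspidal Borel–Jacquet data (`hnorm`: every cuspidal `π` has `t_{π,w} = q_w^{s} t_{P,w}` off a finite
set for some `s ∈ ℂ` and some cuspidal `P ⊂ L²_cusp` with a Satake family; Borel–Jacquet 1979, 5.7)
— then for cuspidal `Π, Π'` on `GL_n(𝔸_F)` (arbitrary central characters),
`rsData t_{Π',v} t_{Π,v} = rsData t_{Π,v} t_{Π,v}` for almost all `v` forces `t_{Π',v} = t_{Π,v}`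
for almost all `v`. Proof (Gelbart, p. 257, "by the same Theorem 5.3.3"), as in
`JacquetShalika_eq_of_rsData_eq_of_L2`: normalise `t_Π = q^{s} t_P`, `t_{Π'} = q^{s'} t_{P'}`; the
hypothesis becomes `q^{s'-s} (t_{P'} ⊗ t_P⁻¹) = t_P ⊗ t_P⁻¹`, whence `re (s' - s) = 0`
(`|∏ t_P| = 1`, `re_eq_zero_of_map_pow_eq_shift`); `t_P⁻¹ = \bar t_P` (unitarity,
`IsSatakeFamilyOf.map_inv_eq_map_conj`), so
`CuspidalAutomorphicRepGL.eq_of_satakeTensor_conj_shift_of_continuity_of_divergence` gives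
`s' = s` (central characters) and `P' = P` (the pole at `1`), and the Satake parameters of `Π, Π'`
agree off a finite set. Rank `0` is trivial (all parameters are `∅`); the automorphic measure exists
by `AdelicGroupData.exists_isAutomorphicMeasure_gl_holds`.
[cite: Gelbart1997, Thm. 5.3.3 and §7.1 p. 257] [cite: ArthurClozelAMS120, Ch. 3 §2 (2.2)–(2.3)]
[cite: BorelJacquetCorvallis1979, 5.7] -/
theorem JacquetShalika_eq_of_rsData_eq_of_normalisation_of_continuity_of_divergence
    (hm1 : ∀ (n : ℕ) (K : Type) [Field K] [NumberField K] (μ : Measure (gl n K).automorphicQuotient)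
      [(gl n K).IsAutomorphicMeasure μ], multiplicity_one_gl n K μ)
    (hcont : ∀ {n : ℕ} {K : Type} [Field K] [NumberField K] {μ : Measure (gl n K).automorphicQuotient}
      [(gl n K).IsAutomorphicMeasure μ], ∀ (_hn : 0 < n) (_h₁ : multiplicity_one_gl n K μ)
      (P P' : CuspidalAutomorphicRepGL n K μ) (_hne : P ≠ P'.conj)
      {S : Set (HeightOneSpectrum (𝓞 K))} (_hS : S.Finite)
      {α β : SatakeFamily K} (_hα : IsSatakeFamilyOf P S α) (_hβ : IsSatakeFamilyOf P' S β),
      ∃ c : ℂ, Tendsto (partialPairL S α β) (𝓝[{s : ℂ | 1 < s.re}] 1) (𝓝 c))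
    (hdiv : ∀ {n : ℕ} {K : Type} [Field K] [NumberField K] {μ : Measure (gl n K).automorphicQuotient}
      [(gl n K).IsAutomorphicMeasure μ], ∀ (_hn : 0 < n) (P P' : CuspidalAutomorphicRepGL n K μ)
      (_he : P = P'.conj) {S : Set (HeightOneSpectrum (𝓞 K))} (_hS : S.Finite)
      {α β : SatakeFamily K} (_hα : IsSatakeFamilyOf P S α) (_hβ : IsSatakeFamilyOf P' S β)
      (d : ℂ), ¬ Tendsto (partialPairL S α β) (𝓝[{s : ℂ | 1 < s.re}] 1) (𝓝 d))
    (hnorm : ∀ {n : ℕ} {K : Type} [Field K] [NumberField K] (hK : isCompact_glFiniteIntegralLevel n K)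
      [NeZero n] (μ : Measure (gl n K).automorphicQuotient) [(gl n K).IsAutomorphicMeasure μ]
      (π : CuspidalAutomorphicRepData n K hK),
      ∃ (s : ℂ) (P : CuspidalAutomorphicRepGL n K μ) (S : Set (HeightOneSpectrum (𝓞 K)))
        (αP : SatakeFamily K), S.Finite ∧ IsSatakeFamilyOf P S αP ∧
        ∀ w ∉ S, ∀ β : Multiset ℂ,
          π.1.HasSatakeParamAt w β ↔ β = (αP w).map (((w.residueCard : ℂ) ^ s) * ·)) :
    JacquetShalika_eq_of_rsData_eq := by
  intro n F _ _ hF P P' hyp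
  rcases Nat.eq_zero_or_pos n with hn0 | hn
  · -- `GL_0`: all Satake parameters are the empty multiset
    subst hn0
    refine Filter.Eventually.of_forall fun w α α' hα hα' => ?_
    rw [Multiset.card_eq_zero.1 hα.card_eq, Multiset.card_eq_zero.1 hα'.card_eq]
  haveI : NeZero n := ⟨hn.ne'⟩
  obtain ⟨μm, hμm⟩ := AdelicGroupData.exists_isAutomorphicMeasure_gl_holds n F
  haveI := hμm
  -- unitary normalisations of `P` and `P'`
  obtain ⟨s, Q, S, αQ, hS, hαQ, hiff⟩ := hnorm hF μm P
  obtain ⟨s', Q', S', αQ', hS', hαQ', hiff'⟩ := hnorm hF μm P'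
  -- the exceptional places
  set E : Set (HeightOneSpectrum (𝓞 F)) := {w | ¬ ∀ α α' : Multiset ℂ,
      P.1.HasSatakeParamAt w α → P'.1.HasSatakeParamAt w α' → rsData α' α = rsData α α} with hE
  have hEfin : E.Finite := Filter.eventually_cofinite.1 hyp
  set T : Set (HeightOneSpectrum (𝓞 F)) := S ∪ S' ∪ E with hT
  have hTfin : T.Finite := (hS.union hS').union hEfin
  have hST : S ⊆ T := fun w hw => Or.inl (Or.inl hw)
  have hS'T : S' ⊆ T := fun w hw => Or.inl (Or.inr hw)
  have hq : ∀ w : HeightOneSpectrum (𝓞 F), (w.residueCard : ℂ) ≠ 0 := fun w => by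
    have := w.one_lt_residueCard
    exact_mod_cast (by omega : w.residueCard ≠ 0)
  have hqs : ∀ (w : HeightOneSpectrum (𝓞 F)) (t : ℂ), (w.residueCard : ℂ) ^ t ≠ 0 := fun w t h0 =>
    hq w ((Complex.cpow_eq_zero_iff _ _).1 h0).1
  -- the shifted relation `q^{s'-s} rsData α_{P'} α_P = rsData α_P α_P` off `T`
  have hrel0 : ∀ w ∉ T, (rsData (αQ' w) (αQ w)).map (((w.residueCard : ℂ) ^ (s' - s)) * ·) =
      rsData (αQ w) (αQ w) := by
    intro w hw
    have hwE : w ∉ E := fun h => hw (Or.inr h)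
    simp only [hE, Set.mem_setOf_eq, not_not] at hwE
    have h := hwE _ _ ((hiff w (fun h => hw (hST h)) _).2 rfl)
      ((hiff' w (fun h => hw (hS'T h)) _).2 rfl)
    have hc : (w.residueCard : ℂ) ^ s' * ((w.residueCard : ℂ) ^ s)⁻¹ =
        (w.residueCard : ℂ) ^ (s' - s) := by
      rw [Complex.cpow_sub _ _ (hq w), div_eq_mul_inv]
    rwa [rsData_map_mul_map_mul, rsData_map_mul_map_mul, hc, mul_inv_cancel₀ (hqs w s),
      map_one_mul] at h
  -- if every place is exceptional there is nothing to prove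
  by_cases hex : ∃ w₀, w₀ ∉ T
  swap
  · simp only [not_exists, not_not] at hex
    exact Filter.eventually_cofinite.2 (hTfin.subset fun w _ => hex w)
  -- `re s = re s'`: unitarity of the central characters of `P`, `P'` at one place
  obtain ⟨w₀, hw₀⟩ := hex
  have hre : (s' - s).re = 0 := by
    have hrel := hrel0 w₀ hw₀
    obtain ⟨𝔫, -, -, ϖ, hSat⟩ := hαQ w₀ (fun h => hw₀ (hST h))
    obtain ⟨𝔫', -, -, ϖ', hSat'⟩ := hαQ' w₀ (fun h => hw₀ (hS'T h))
    have hn1 : ‖(rsData (αQ w₀) (αQ w₀)).prod‖ = 1 := by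
      rw [prod_rsData, norm_mul, norm_pow, norm_pow, norm_inv, hSat.norm_prod_eq_one]
      simp
    have hn1' : ‖(rsData (αQ' w₀) (αQ w₀)).prod‖ = 1 := by
      rw [prod_rsData, norm_mul, norm_pow, norm_pow, norm_inv, hSat.norm_prod_eq_one,
        hSat'.norm_prod_eq_one]
      simp
    refine re_eq_zero_of_map_pow_eq_shift (f := 1) w₀.one_lt_residueCard one_pos ?_ hn1 hn1' ?_
    · rw [card_rsData', hSat'.card_eq, hSat.card_eq]
      exact Nat.mul_ne_zero hn.ne' hn.ne'
    · rw [hrel]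
  set τ : ℝ := (s' - s).im with hτ
  have hsτ : s' - s = (τ : ℂ) * Complex.I := by
    apply Complex.ext
    · simp [hre]
    · simp [hτ]
  -- unitarity `t_P⁻¹ = \bar t_P`: the relation in conjugate form, and the `L²` theorem
  have hrel : ∀ w ∉ T, (satakeTensor (αQ' w) ((αQ w).map (starRingEnd ℂ))).map
      (((w.residueCard : ℂ) ^ ((τ : ℂ) * Complex.I)) * ·) =
        satakeTensor (αQ w) ((αQ w).map (starRingEnd ℂ)) := by
    intro w hw
    have hwS : w ∉ S := fun h => hw (hST h)
    rw [← hαQ.map_inv_eq_map_conj hwS, ← rsData_eq_satakeTensor_map_inv,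
      ← rsData_eq_satakeTensor_map_inv, ← hsτ]
    exact hrel0 w hw
  obtain ⟨hτ0, hQ⟩ :=
    CuspidalAutomorphicRepGL.eq_of_satakeTensor_conj_shift_of_continuity_of_divergence hn
      (hm1 n F μm) hcont hdiv Q Q' hTfin (hαQ.mono hST) (hαQ'.mono hS'T) τ hrel
  -- hence `s' = s` and the two families agree off `T`
  have hss : s' = s := by
    have : s' - s = 0 := by rw [hsτ, hτ0, Complex.ofReal_zero, zero_mul]
    exact sub_eq_zero.1 this
  subst hQ
  have hfam : ∀ w ∉ T, αQ' w = αQ w := fun w hw =>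
    hαQ'.eq_of_not_mem hαQ (fun h => hw (hS'T h)) (fun h => hw (hST h))
  have hnotT : ∀ᶠ w : HeightOneSpectrum (𝓞 F) in cofinite, w ∉ T := by
    rw [Filter.eventually_cofinite]
    simpa using hTfin
  filter_upwards [hnotT] with w hw β β' hβ hβ'
  rw [(hiff w (fun h => hw (hST h)) β).1 hβ, (hiff' w (fun h => hw (hS'T h)) β').1 hβ', hfam w hw,
    hss]

/-- **`JacquetShalika_eq_of_rsData_eq` from the named facts (2.2) at `s = 1`, (2.3), multiplicity
one, over any unitary normalisation** (the named-fact form of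
`JacquetShalika_eq_of_rsData_eq_of_normalisation_of_continuity_of_divergence`; the non-vanishing
half of (2.2) and the residue in (2.3) are not used). [cite: Gelbart1997, Thm. 5.3.3 and §7.1 p. 257]
[cite: ArthurClozelAMS120, Ch. 3 §2 (2.2)–(2.3)] -/
theorem JacquetShalika_eq_of_rsData_eq_of_normalisation
    (h22 : ∀ {n : ℕ} {K : Type} [Field K] [NumberField K] {μ : Measure (gl n K).automorphicQuotient}
      [(gl n K).IsAutomorphicMeasure μ],
      JacquetShalika1981_partialPairL_at_one_of_ne_conj (n := n) (K := K) (μ := μ))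
    (h23 : ∀ {n : ℕ} {K : Type} [Field K] [NumberField K] {μ : Measure (gl n K).automorphicQuotient}
      [(gl n K).IsAutomorphicMeasure μ],
      JacquetShalika1981_partialPairL_pole_of_eq_conj (n := n) (K := K) (μ := μ))
    (hm1 : ∀ (n : ℕ) (K : Type) [Field K] [NumberField K] (μ : Measure (gl n K).automorphicQuotient)
      [(gl n K).IsAutomorphicMeasure μ], multiplicity_one_gl n K μ)
    (hnorm : ∀ {n : ℕ} {K : Type} [Field K] [NumberField K] (hK : isCompact_glFiniteIntegralLevel n K)
      [NeZero n] (μ : Measure (gl n K).automorphicQuotient) [(gl n K).IsAutomorphicMeasure μ]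
      (π : CuspidalAutomorphicRepData n K hK),
      ∃ (s : ℂ) (P : CuspidalAutomorphicRepGL n K μ) (S : Set (HeightOneSpectrum (𝓞 K)))
        (αP : SatakeFamily K), S.Finite ∧ IsSatakeFamilyOf P S αP ∧
        ∀ w ∉ S, ∀ β : Multiset ℂ,
          π.1.HasSatakeParamAt w β ↔ β = (αP w).map (((w.residueCard : ℂ) ^ s) * ·)) :
    JacquetShalika_eq_of_rsData_eq :=
  JacquetShalika_eq_of_rsData_eq_of_normalisation_of_continuity_of_divergence hm1
    (fun h0 h₁ => continuity_of_JacquetShalika1981_partialPairL_at_one_of_ne_conj h22 h0 h₁)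
    (fun h0 => divergence_of_JacquetShalika1981_partialPairL_pole_of_eq_conj h23 h0)
    hnorm

end Glue

/-! ### The three bases -/

section Leaves

/-- **`JacquetShalika_eq_of_rsData_eq` from six named-fact leaves (Borel–Jacquet dictionary
form)**: `JacquetShalika_eq_of_rsData_eq_of_leaves'` of `LanglandsTetrahedralLeaves` with its
hypothesis `h22'` (`JacquetShalika1981_partialPairL_boundary_of_ne_one`, Shahidi's non-vanishing on
`re s = 1`) removed. Base: `JacquetShalika1981_partialPairL_at_one_of_ne_conj`, `…_pole_of_eq_conj`,
`multiplicity_one_gl`, `AutomorphicRepsGL.exists_isAssociatedL2`, `hasSatakeParamAt_iff_L2`,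
`AutomorphicRepsGL.stable_cuspidal_eq_sSup_irreducible`; the normalisation is
`CuspidalAutomorphicRepData.exists_satake_eq_cpow_mul_L2_of_clean` with clean models from
`CuspidalAutomorphicRepData.exists_clean_hasSatakeParamAt_of_sSup_irreducible'`.
[cite: Gelbart1997, Thm. 5.3.3 and §7.1 p. 257] [cite: BorelJacquetCorvallis1979, §4.6 and 5.7] -/
theorem JacquetShalika_eq_of_rsData_eq_of_leaves''
    (h22 : ∀ {n : ℕ} {K : Type} [Field K] [NumberField K] {μ : Measure (gl n K).automorphicQuotient}
      [(gl n K).IsAutomorphicMeasure μ],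
      JacquetShalika1981_partialPairL_at_one_of_ne_conj (n := n) (K := K) (μ := μ))
    (h23 : ∀ {n : ℕ} {K : Type} [Field K] [NumberField K] {μ : Measure (gl n K).automorphicQuotient}
      [(gl n K).IsAutomorphicMeasure μ],
      JacquetShalika1981_partialPairL_pole_of_eq_conj (n := n) (K := K) (μ := μ))
    (hm1 : ∀ (n : ℕ) (K : Type) [Field K] [NumberField K] (μ : Measure (gl n K).automorphicQuotient)
      [(gl n K).IsAutomorphicMeasure μ], multiplicity_one_gl n K μ)
    (hA : ∀ {n : ℕ} {K : Type} [Field K] [NumberField K] (hK : isCompact_glFiniteIntegralLevel n K)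
      (μ : Measure (gl n K).automorphicQuotient) [(gl n K).IsAutomorphicMeasure μ],
      AutomorphicRepsGL.exists_isAssociatedL2 hK μ)
    (hL2 : ∀ {n : ℕ} {K : Type} [Field K] [NumberField K] (hK : isCompact_glFiniteIntegralLevel n K)
      (μ : Measure (gl n K).automorphicQuotient) [(gl n K).IsAutomorphicMeasure μ],
      hasSatakeParamAt_iff_L2 hK μ)
    (hss : ∀ {n : ℕ} {K : Type} [Field K] [NumberField K] (hK : isCompact_glFiniteIntegralLevel n K),
      AutomorphicRepsGL.stable_cuspidal_eq_sSup_irreducible hK) :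
    JacquetShalika_eq_of_rsData_eq :=
  JacquetShalika_eq_of_rsData_eq_of_normalisation h22 h23 hm1 fun hK _ μ _ π => by
    obtain ⟨π₀, h0, h0π⟩ :=
      CuspidalAutomorphicRepData.exists_clean_hasSatakeParamAt_of_sSup_irreducible' (hss hK) π
    exact CuspidalAutomorphicRepData.exists_satake_eq_cpow_mul_L2_of_clean (hA hK μ) (hL2 hK μ) π π₀
      h0 h0π

/-- **`JacquetShalika_eq_of_rsData_eq` from five named-fact leaves (realisation form).** Base:
`JacquetShalika1981_partialPairL_at_one_of_ne_conj`, `…_pole_of_eq_conj`, `multiplicity_one_gl`,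
`AutomorphicRepsGL.exists_le_formsOfL2_of_W'_eq_bot` (an irreducible stable space of
`A_G`-invariant cusp forms lies in some `V_Π`) and `AutomorphicRepsGL.stable_cuspidal_eq_sSup_irreducible`;
the normalisation is `CuspidalAutomorphicRepData.exists_satake_eq_cpow_mul_L2_of_realisation`
(`PairLFunctionPolesRepDataRealisation`). So the discharge `JacquetShalika_eq_of_rsData_eq_holds`
is this theorem fed with the five `_holds`. [cite: Gelbart1997, Thm. 5.3.3 and §7.1 p. 257]
[cite: BorelJacquetCorvallis1979, §4.6 and 5.7] -/
theorem JacquetShalika_eq_of_rsData_eq_of_realisation_leaves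
    (h22 : ∀ {n : ℕ} {K : Type} [Field K] [NumberField K] {μ : Measure (gl n K).automorphicQuotient}
      [(gl n K).IsAutomorphicMeasure μ],
      JacquetShalika1981_partialPairL_at_one_of_ne_conj (n := n) (K := K) (μ := μ))
    (h23 : ∀ {n : ℕ} {K : Type} [Field K] [NumberField K] {μ : Measure (gl n K).automorphicQuotient}
      [(gl n K).IsAutomorphicMeasure μ],
      JacquetShalika1981_partialPairL_pole_of_eq_conj (n := n) (K := K) (μ := μ))
    (hm1 : ∀ (n : ℕ) (K : Type) [Field K] [NumberField K] (μ : Measure (gl n K).automorphicQuotient)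
      [(gl n K).IsAutomorphicMeasure μ], multiplicity_one_gl n K μ)
    (hre : ∀ {n : ℕ} {K : Type} [Field K] [NumberField K] (hK : isCompact_glFiniteIntegralLevel n K)
      (μ : Measure (gl n K).automorphicQuotient) [(gl n K).IsAutomorphicMeasure μ],
      AutomorphicRepsGL.exists_le_formsOfL2_of_W'_eq_bot hK μ)
    (hss : ∀ {n : ℕ} {K : Type} [Field K] [NumberField K] (hK : isCompact_glFiniteIntegralLevel n K),
      AutomorphicRepsGL.stable_cuspidal_eq_sSup_irreducible hK) :
    JacquetShalika_eq_of_rsData_eq :=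
  JacquetShalika_eq_of_rsData_eq_of_normalisation h22 h23 hm1 fun hK _ μ _ π =>
    CuspidalAutomorphicRepData.exists_satake_eq_cpow_mul_L2_of_realisation hre (fun hK _ π =>
      CuspidalAutomorphicRepData.exists_clean_hasSatakeParamAt_of_sSup_irreducible (hss hK) π) hK μ π

/-- **`JacquetShalika_eq_of_rsData_eq` from five named-fact leaves (closure form).** Base:
`JacquetShalika1981_partialPairL_at_one_of_ne_conj`, `…_pole_of_eq_conj`, `multiplicity_one_gl`,
`AutomorphicRepsGL.cuspidal_closure_exists_mem_l2OfForms` (Harish-Chandra's density half) and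
`AutomorphicRepsGL.stable_cuspidal_eq_sSup_irreducible`, through
`AutomorphicRepsGL.exists_le_formsOfL2_of_W'_eq_bot_of_closure_exists_mem` (cusp forms are bounded,
`AutomorphicRepsGL.cuspidal_bounded_holds`). [cite: Gelbart1997, Thm. 5.3.3 and §7.1 p. 257]
[cite: BorelJacquetCorvallis1979, §4.6 and 5.7] -/
theorem JacquetShalika_eq_of_rsData_eq_of_closure_leaves
    (h22 : ∀ {n : ℕ} {K : Type} [Field K] [NumberField K] {μ : Measure (gl n K).automorphicQuotient}
      [(gl n K).IsAutomorphicMeasure μ],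
      JacquetShalika1981_partialPairL_at_one_of_ne_conj (n := n) (K := K) (μ := μ))
    (h23 : ∀ {n : ℕ} {K : Type} [Field K] [NumberField K] {μ : Measure (gl n K).automorphicQuotient}
      [(gl n K).IsAutomorphicMeasure μ],
      JacquetShalika1981_partialPairL_pole_of_eq_conj (n := n) (K := K) (μ := μ))
    (hm1 : ∀ (n : ℕ) (K : Type) [Field K] [NumberField K] (μ : Measure (gl n K).automorphicQuotient)
      [(gl n K).IsAutomorphicMeasure μ], multiplicity_one_gl n K μ)
    (h₃ : ∀ {n : ℕ} {K : Type} [Field K] [NumberField K] (hK : isCompact_glFiniteIntegralLevel n K)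
      (μ : Measure (gl n K).automorphicQuotient) [(gl n K).IsAutomorphicMeasure μ],
      AutomorphicRepsGL.cuspidal_closure_exists_mem_l2OfForms hK μ)
    (hss : ∀ {n : ℕ} {K : Type} [Field K] [NumberField K] (hK : isCompact_glFiniteIntegralLevel n K),
      AutomorphicRepsGL.stable_cuspidal_eq_sSup_irreducible hK) :
    JacquetShalika_eq_of_rsData_eq :=
  JacquetShalika_eq_of_rsData_eq_of_realisation_leaves h22 h23 hm1
    (fun hK μ _ => AutomorphicRepsGL.exists_le_formsOfL2_of_W'_eq_bot_of_closure_exists_mem hK μ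
      (h₃ hK μ)) hss

end Leaves

end Literature.NumberTheory.Automorphic
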